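import Literature.NumberTheory.Sieve.FGKMT2018Theorem1OfTheorem5
import HarnessLib

/-!
# Ford–Green–Konyagin–Maynard–Tao 2018, Theorem 5 in the LOCAL form its proof gives (`u = u(r, x)`), and Theorem 4 from it

Topic `Literature/NumberTheory/Sieve`. Source: K. Ford, B. Green, S. Konyagin, J. Maynard, T. Tao,
*Long gaps between primes*, J. Amer. Math. Soc. 31 (2018) 65–105 = arXiv:1412.5029
[FordGreenKonyaginMaynardTao2018], Theorem 5 p. 17 and its proof §§7–8 pp. 20–24; in particular §8
p. 23: «We set `τ := 2 (B^k/φ(B)^k) 𝔖 (log R)^k (log x)^k I_k` and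
`u := (φ(B)/B) (log R/log x) (k J_k/(2 I_k))`. Since `B` is either `1` or prime, we have `φ(B)/B ≍ 1` …
From (7.x) we thus obtain `u ≍ log r`.»

TYPING NOTE (why this file exists). The printed Theorem 5 says «a positive quantity `u = u(r)` depending
only on `r` with `u ≍ log r`», and `FordGreenKonyaginMaynardTao2018_theorem5`
(`FGKMT2018RandomConstruction`) renders this literally: `∃ u : ℕ → ℝ` is chosen BEFORE `x`. The proof
in §8, however, produces `u = (φ(B)/B)(log R/log x) · r J_r/(2 I_r)` where `B = B(x)` is the
Landau–Page exceptional prime of Lemma 7.2 / Corollary 5 (`B = 1` or a prime `B ≫ log₂ x`) and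
`R = (x/4)^{1/9}`: so `u` depends on `x` through the factor `φ(B)/B = 1 − 1/B = 1 + O(1/log₂ x)`,
a deviation that can NOT be absorbed into the relative errors `O(1/log₂^{10} x)` of (6.3)–(6.4)
(and `B` cannot be avoided: the saving `log^{-100k²} x` of Hypothesis 1 with `k² ≍ log^{2/5} x`
is beyond Siegel–Walfisz). What §§7–8 prove, and all that the deduction of Theorem 4 in §6 uses
(`u` enters only through the number `m = u x/(2y)` at the given `x`, and `C = C(x)` is existential in
Theorem 4), is the LOCAL form below: `u` is chosen after `x` (and `H`), with the UNIFORM bounds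
`u₁ log r ≤ u ≤ u₂ log r`. This file states that form as the named fact
`FordGreenKonyaginMaynardTao2018_theorem5_local` (the honest bottom of the large-gaps DAG, implied
by the printed form: `theorem5_local_of_theorem5`), and PROVES Theorem 4 — hence Theorems 2, 1 and
every `RankinConstant κ` — from it, by the assembly of `FGKMT2018Theorem4Proof` verbatim with `u(#H)`
replaced by the local `u`.
-/

noncomputable section

open Finset Filter

namespace Literature.NumberTheory.Sieve

open FGKMT2018

/-- **Theorem 5 (Existence of good sieve weight), local form** of [FordGreenKonyaginMaynardTao2018, §6
p. 17 with §8 p. 23]: as `FordGreenKonyaginMaynardTao2018_theorem5`, except that the quantity `u` with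
`u₁ log r ≤ u ≤ u₂ log r` (6.2′) is chosen together with `τ` and `w` AFTER `x` and the tuple `H`
(in the proof `u = (φ(B)/B)(log R/log x) r J_r/(2I_r)` with the exceptional prime `B = B(x)`); the
constants `r₀, u₁, u₂` are absolute. For every fixed `0 < c ≤ 1`, `K'`, `ε > 0` there is `K` with, for
all large `x`, `y = c x log x log₃ x/log₂ x`, `𝒫, 𝒬` as in (3.4)–(3.5): for every admissible `H` of
`r` integers, `r₀ ≤ r ≤ log^{1/5} x`, `H ⊆ [1, 2r²]`, there are `τ ≥ x^{-ε}`, `u ∈ [u₁ log r, u₂ log r]`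
and a non-negative `w : 𝒫 × ℤ → ℝ` supported on `𝒫 × [−y, y]` with (6.3)–(6.6) (relative errors
`K/log₂^{10} x`). [cite: FordGreenKonyaginMaynardTao2018, Thm 5 (§6 p. 17) with §8 p. 23 (definition of u)] -/
def FordGreenKonyaginMaynardTao2018_theorem5_local : Prop :=
  ∃ (r₀ : ℕ) (u₁ u₂ : ℝ), 0 < u₁ ∧ u₁ ≤ u₂ ∧
    ∀ c : ℝ, 0 < c → c ≤ 1 → ∀ K' : ℝ, 0 < K' → ∀ ε : ℝ, 0 < ε → ∃ K : ℝ, 0 < K ∧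
      ∀ᶠ x : ℕ in atTop, ∀ H : Finset ℤ, IsAdmissibleTuple H → r₀ ≤ #H →
        (#H : ℝ) ≤ (Real.log x) ^ ((1 : ℝ) / 5) → (∀ h ∈ H, 1 ≤ h ∧ h ≤ 2 * (#H : ℤ) ^ 2) →
        ∃ τ : ℝ, (x : ℝ) ^ (-ε) ≤ τ ∧ ∃ u : ℝ, u₁ * Real.log #H ≤ u ∧ u ≤ u₂ * Real.log #H ∧
         ∃ w : ℕ → ℤ → ℝ,
          (∀ p n, 0 ≤ w p n) ∧
          (∀ p n, w p n ≠ 0 → p ∈ primesHalf x ∧ |(n : ℝ)| ≤ ySieve c x) ∧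
          (∀ p ∈ primesHalf x,
            |∑ n ∈ weightWindow c x, w p n - τ * ySieve c x / Real.log x ^ #H|
              ≤ K / (Real.log^[2] x) ^ 10 * (τ * ySieve c x / Real.log x ^ #H)) ∧
          (∀ q ∈ primesQ c x, ∀ h ∈ H,
            |∑ p ∈ primesHalf x, w p ((q : ℤ) - h * p)
                - τ * (u / #H) * ((x : ℝ) / (2 * Real.log x ^ #H))|
              ≤ K / (Real.log^[2] x) ^ 10 * (τ * (u / #H) * ((x : ℝ) / (2 * Real.log x ^ #H)))) ∧
          (∀ h : ℤ, |(h : ℝ)| ≤ K' * ySieve c x / x → h ∉ H →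
            ∑ q ∈ primesQ c x, ∑ p ∈ primesHalf x, w p ((q : ℤ) - h * p)
              ≤ K / (Real.log^[2] x) ^ 10 * (τ * ((x : ℝ) / Real.log x ^ #H)
                  * (ySieve c x / Real.log x))) ∧
          (∀ p n, w p n ≤ (x : ℝ) ^ (1 / 3 + ε : ℝ))

/-- The printed form implies the local form (take `u := u(#H)`).
[cite: FordGreenKonyaginMaynardTao2018, Thm 5 p. 17] -/
theorem theorem5_local_of_theorem5 (h : FordGreenKonyaginMaynardTao2018_theorem5) :
    FordGreenKonyaginMaynardTao2018_theorem5_local := by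
  obtain ⟨u, r₀, u₁, u₂, hu₁, hu₁₂, hu, h5⟩ := h
  refine ⟨r₀, u₁, u₂, hu₁, hu₁₂, fun c hc hc1 K' hK' ε hε => ?_⟩
  obtain ⟨K, hK, h⟩ := h5 c hc hc1 K' hK' ε hε
  refine ⟨K, hK, ?_⟩
  filter_upwards [h] with x hx H hadm hr hH5 hHb
  obtain ⟨τ, hτ, w, hw⟩ := hx H hadm hr hH5 hHb
  exact ⟨τ, hτ, u #H, (hu _ hr).1, (hu _ hr).2, w, hw⟩

namespace FGKMT2018

/-- `log^[2] t = log log t`. [folklore] -/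
private theorem t5l_iter_two (t : ℝ) : Real.log^[2] t = Real.log (Real.log t) := by
  simp [Function.iterate_succ_apply']

/-- `log x ≥ 1 ⟹ x > 1` (for natural `x`). [folklore] -/
private theorem t5l_one_lt_of_log {x : ℕ} (h : 1 ≤ Real.log x) : (1 : ℝ) < x := by
  by_contra hx
  have := Real.log_nonpos (Nat.cast_nonneg x) (not_lt.1 hx)
  linarith

end FGKMT2018

/-- **FGKMT Theorem 4 from the local Theorem 5** (the deduction of §6, pp. 17–19, exactly as in
`fgkmt2018_theorem4_of_theorem5`: `u` is only used at the given `x`).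
[cite: FordGreenKonyaginMaynardTao2018, §6 pp. 17–19: Thm 4 (p. 13) from Thm 5 (p. 17)] -/
theorem fgkmt2018_theorem4_of_theorem5_local :
    FordGreenKonyaginMaynardTao2018_theorem5_local → FordGreenKonyaginMaynardTao2018_theorem4 := by
  classical
  rintro ⟨r₀, u₁, u₂, hu₁, hu₁₂, h5⟩
  have hu₂ : 0 ≤ u₂ := by linarith
  refine ⟨u₁ / 2000, u₂ / 700, by positivity, by linarith, fun c hc hc1 => ?_⟩
  obtain ⟨K, hK, h5x⟩ := h5 c hc hc1 1 one_pos (1 / 100) (by norm_num)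
  have hℓ₂ : Tendsto (fun x : ℕ => Real.log (Real.log x)) atTop atTop :=
    Real.tendsto_log_atTop.comp (Real.tendsto_log_atTop.comp tendsto_natCast_atTop_atTop)
  filter_upwards [h5x, params_growth, inv_log_le_sigma, log_div_sigma_pow_le,
    log_shiftCount_bounds, le_ySieve hc, card_primesQ_le hc, boxExp_card_sievedQ_le hc,
    sigma_mul_ySieve_asymp (show (0 : ℝ) < 1 / 100 by norm_num), diam_le_cube,
    eventually_le_shiftCount r₀, thm4_rpow_growth,
    hℓ₂.eventually_ge_atTop (100 * K + 30 * K * u₂ ^ 2 / c + 32 * u₂ ^ 2 / c + 3879 * u₂ +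
      (u₂ / 700 / c + 1))] with x h5 hg hσL hLσ hlr hxy hnQ hB1 hσy hdiam hr₀ hρ hA0
  obtain ⟨h1, h2, -, h81, hLx, h200, h2r5, h7⟩ := hg
  -- `log^[2] = log log`
  rw [t5l_iter_two] at h5 hσy ⊢
  have hL0 : 0 < Real.log x := by linarith
  have hL1 : 1 ≤ Real.log x := by linarith
  have hx1 : (1 : ℝ) ≤ x := (t5l_one_lt_of_log hL1).le
  have hL₂0 : 0 < Real.log (Real.log x) := by linarith
  have hL₂L : Real.log (Real.log x) ≤ Real.log x :=
    (Real.log_le_sub_one_of_pos hL0).trans (by linarith)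
  -- the tuple `H = sqShifts r`, `r = ⌊log^{1/5} x⌋`
  obtain ⟨H, hHdef⟩ : ∃ H : Finset ℤ, H = sqShifts (shiftCount x) := ⟨_, rfl⟩
  have hHc : #H = shiftCount x := by rw [hHdef]; exact card_sqShifts _
  have hspec := sqShifts_shiftCount_spec x
  rw [← hHdef] at hspec
  obtain ⟨hadm, hH5, hHb⟩ := hspec
  rw [← hHc] at hLσ hlr hdiam hr₀
  have hdiam' := hdiam c hc hc1
  have hH2 : 2 ≤ #H := by
    rw [hHc]
    exact Nat.le_floor (by exact_mod_cast h2r5)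
  have hH1 : 1 ≤ #H := le_trans (by norm_num) hH2
  have hrL : (#H : ℝ) ≤ Real.log x := by rw [hHc]; exact shiftCount_le_log hL1
  have hr2 : (#H : ℝ) ^ 2 ≤ Real.log x := by rw [hHc]; exact shiftCount_sq_le hL1
  have hHsqrt : (#H : ℝ) ≤ Real.sqrt (Real.log x) := by rw [hHc]; exact shiftCount_le_sqrt hL1
  have h2rS : 2 * #H ≤ sMin x := by rw [hHc]; exact two_mul_shiftCount_le_sMin h1
  have hδ := delta_le hL1 h2
  rw [← hHc] at hδ
  have hEe := (exp_shift_ge (x := x) hL1).2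
  rw [← hHc] at hEe
  have h4L : 4 * Real.log x ≤ x := by
    have h8 : 8 ≤ Real.log x := by
      have he := Real.add_one_le_exp (7 : ℝ)
      have h' : Real.exp 7 ≤ Real.log x := by
        have := Real.exp_le_exp.2 h7
        rwa [Real.exp_log hL0] at this
      linarith
    nlinarith [hLx]
  have h4rx : 4 * (#H : ℝ) ^ 2 ≤ x := by rw [hHc]; exact four_mul_sq_shiftCount_le hL1 h4L
  have h200H : 200 * ((#H : ℝ) * Real.log (Real.log x)) ≤ Real.log x :=
    le_trans (mul_le_mul_of_nonneg_left (mul_le_mul_of_nonneg_right hH5 hL₂0.le) (by norm_num))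
      h200
  -- `σ` as `sigmaProd 𝒮`
  rw [sigma_eq_sigmaProd] at hσL hLσ hσy
  have hσy' : 99 / 100 * (80 * c * x * Real.log (Real.log x)) ≤
        sigmaProd (primesS x) * ySieve c x ∧
      sigmaProd (primesS x) * ySieve c x ≤ 101 / 100 * (80 * c * x * Real.log (Real.log x)) := by
    have h := hσy c hc
    constructor
    · linarith [h.1]
    · linarith [h.2]
  -- the sieve weight of Theorem 5 for `H`
  obtain ⟨τ, hτ, u, hur1, hur2, w, hw, hsupp, h63, h64, -, hWle⟩ := h5 H hadm hr₀ hH5 hHb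
  -- the constants at `x`
  have hlogH0 : 0 ≤ Real.log (#H : ℝ) := le_trans (by positivity) hlr.1
  have hur0 : 0 ≤ u := le_trans (mul_nonneg hu₁.le hlogH0) hur1
  have hur5 : u ≤ u₂ * Real.log (Real.log x) / 5 := by
    have := mul_le_mul_of_nonneg_left hlr.2 hu₂
    linarith [hur2]
  have hs1 : 0 ≤ 30 * K * u₂ ^ 2 / c := by positivity
  have hs2 : 0 ≤ 32 * u₂ ^ 2 / c := by positivity
  have hs3 : 0 ≤ u₂ / 700 / c := by positivity
  have hL₂p4 : Real.log (Real.log x) ≤ Real.log (Real.log x) ^ 4 := le_self_pow₀ h2 (by norm_num)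
  have hL₂p10 : Real.log (Real.log x) ≤ Real.log (Real.log x) ^ 10 :=
    le_self_pow₀ h2 (by norm_num)
  have hA : 100 * K ≤ Real.log (Real.log x) ^ 10 := by linarith
  have hB2a : 30 * K * u₂ ^ 2 / c ≤ Real.log (Real.log x) ^ 4 := by linarith
  have hB2b : 32 * u₂ ^ 2 / c ≤ Real.log x := by linarith
  have hB2c : 3879 * u₂ ≤ Real.log x := by linarith
  have hfin : u₂ / 700 / c + 1 ≤ Real.log x := by linarith
  -- a good residue vector, and the conclusion
  obtain ⟨f, -, hF1, hF2, hF3⟩ := thm4_exists_good (ur := u) hc hx1 h1 h2 hxy hLσ hρ hσy'.1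
    hnQ hB1 hH1 hrL hr2 h2rS hδ hEe hHb hdiam' h4rx hK hu₂ hur0 hur5 hA hB2a hB2b hB2c hτ hw
    hsupp h63 h64 hWle
  exact thm4_of_good hc hx1 h1 h2 h81 h200H hxy hLσ hρ hσy' hH1 hrL hHsqrt hlr hu₁ hur1 hur2
    hfin hK hA hτ hw hsupp h63 hWle f hF1 hF2 hF3

/-- **FGKMT Theorem 2 from the local Theorem 5** (Theorem 3 being proved).
[cite: FordGreenKonyaginMaynardTao2018, Thm 2 from Thm 3 (§5) + Thm 5 (§§6–8)] -/
theorem fgkmt2018_theorem2_of_theorem5_local (h5 : FordGreenKonyaginMaynardTao2018_theorem5_local) :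
    FordGreenKonyaginMaynardTao2018_theorem2 :=
  fgkmt2018_theorem2_of_theorem3_theorem4 Literature.Combinatorics.Hypergraph.fgkmt2018_theorem3
    (fgkmt2018_theorem4_of_theorem5_local h5)

/-- **FGKMT Theorem 1 (`G(X) ≫ log X log₂ X log₄ X / log₃ X`) from the local Theorem 5.**
[cite: FordGreenKonyaginMaynardTao2018, Thm 1 from Thm 5 via Thms 2, 3, 4 (§§3–6)] -/
theorem fgkmt2018_theorem1_of_theorem5_local (h5 : FordGreenKonyaginMaynardTao2018_theorem5_local) :
    FordGreenKonyaginMaynardTao2018_theorem1 :=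
  fgkmt2018_theorem1_of_theorem3_theorem4 Literature.Combinatorics.Hypergraph.fgkmt2018_theorem3
    (fgkmt2018_theorem4_of_theorem5_local h5)

/-- **Every Rankin constant from the local Theorem 5**: `RankinConstant κ` for all real `κ`.
[cite: FordGreenKonyaginMaynardTao2018, Thm 1 ⇒ Rankin's conjecture (§1)] -/
theorem rankinConstant_of_fgkmt2018_theorem5_local
    (h5 : FordGreenKonyaginMaynardTao2018_theorem5_local) (κ : ℝ) : RankinConstant κ :=
  rankinConstant_of_fgkmt2018_theorem3_theorem4 Literature.Combinatorics.Hypergraph.fgkmt2018_theorem3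
    (fgkmt2018_theorem4_of_theorem5_local h5) κ

end Literature.NumberTheory.Sieve
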